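import Summits.QuantumFields.YangMills.Theorems.BalabanUVNodesN16Eq04SameBlocksNonAbelian
import Summits.QuantumFields.YangMills.Theorems.BalabanUVNodesN16AveragingPin
import Literature.MathematicalPhysics.QuantumFieldTheory.Balaban1983to89.Node00.AveragingSmooth
import Literature.MathematicalPhysics.QuantumFieldTheory.Balaban1983to89.LatticeWordStokes
import HarnessLib

/-!
# YM-DAG node N16 (NE3), the located averaging pin (42) ↔ (0.4) — part 25: THE TORUS BRIDGE — the (0.4) average OF RECORD (`Node00.avOfRecord = blockAvg expMeanLogSU`),
# on its guard, written in b07 letters over the record's lift, and its exponent IDENTIFIED with part 22's displayed (0.4)-shaped exponent: part 22's second-order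
# bound `‖X₀.₄ − X₄₂ − (exact coarse gradient)‖ ≤ ρ₂(ℓ_s,a) + ρ₂(ℓ,a)` holds VERBATIM for the scheme of record

Cell `pub-ymgap`, width seat `pub-ymgap-dag-n16-w3` (director-ym №197 ∕ HUMAN RULING D-0149), generation 8; part 25 of the W1b lineage (g0 p584628 `liftCfgOfRecord₁₁`∕`step04`;
part 13 p614236 and part 22 p630593 — the (0.4)-SHAPED recipe on the B7 fold at base point `q+s`, «the torus-typed (0.4) OBJECT is not bridged here (g0's (d1)–(d3))»).
`--kind proof --supports stmt-QuantumFields-27366 --as helper` (K3⁸; count-neutral; 0 `def`).  `bears_on: R4∕N16`.  g5∕g7 «Not done: the torus-typed (0.4) object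
`BlockAveraging.blockAvg` is still not bridged to the ℤᵈ `bavg` calculus».

THE POINT.  Parts 13∕22 quantified the pin on a fold-side MODEL of (0.4) (symmetrised stars from the base point `q+s`, exp-mean-log, sums DISPLAYED); whether that model IS
the tree's averaging of record was left open.  This file proves it is, on the (0.4) guard:
 * §1 THE WORDS: `BlockAveraging`'s `axisRun = seg`, `stairRuns = tw`, ★ `stairWord σ n = permWord (σ * Fin.revPerm) n` (b12's permuted tree words, axes listed in the opposite
   order), `wordRev = revWord` (`rfl`), so ★ `loopWord L μ n σ σ′ = permWord (σ·rev) n ++ seg μ L ++ revWord (permWord (σ′·rev) n) ++ seg μ (−L)` (`loopWord_eq`).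
 * §2 THE TRANSPORTS: `toTorusSite (x ± e_μ) = (toTorusSite x).shift∕unshift μ` and ★ `coe_hol_lift`: the b07 transport of the record's lift `liftCfgOfRecord₁₁ F N t k V`
   along ANY word from ANY `ℤ⁴` point `x` has the matrix of n07-e's walk product `Node00.holM ↑V (walk (toTorusSite x) w)` (induction on the word).
 * §3 ★ `coe_avOfRecord_avg_of_small`: on the guard `Small expMeanLogSU V c`, `↑((avOfRecord F N t k).avg V c) = exp(Σ_i |Idx|⁻¹ log V̂(loop_i)) · V̂(seg c.dir L)`, `V̂` the lift
   read from the `ℤ⁴` section of the block centre `emb c₋` (n07-e's `Node00.coe_avgFun_of_small`, `ExpMeanLog.eml_eq_exp_sum`, §2).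
 * §4 ★★ `sum_idx_eq_symSum`: for ANY `ℤ⁴` configuration, that `Idx`-mean from the centre `q + s`, `s = h·𝟙`, `h = (L−1)∕2`, EQUALS part 22's displayed double mean at
   `(q, s)` (uniform weight `|Idx|⁻¹ = L⁻⁴(4!)⁻²`, `Fintype.sum_prod_type`, the bijections `σ ↦ σ·rev` of `S₄`, `boxVec L r − s = off r` by `rfl`).
 * §5 ★★★ `norm_Xrecord_sub_Xavg_sub_coarseGrad_le`: part 22's `norm_X04avg_sub_Xavg_sub_coarseGrad_le` with its (0.4)-shaped sum REPLACED by the exponent of record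
   (`d = 4`, `𝔸 = M_N(ℂ)`, `s = h·𝟙`): in a local exponential gauge the exponent of THE SCHEME OF RECORD at a block is (42)'s exponent at the block's corner moved by
   part 13's EXACT coarse gradient up to `ρ₂(ℓ_s,a) + ρ₂(ℓ,a)`; ★★ `coe_avOfRecord_avg_eq_exp_corner` (the record's average read from the corner `q_c = section(emb c₋) − s`); `…_of_plaqSmall`: on small fields
   (`((6L)²∕4)·δ < min(1∕3, π∕N)`, ym3-torus' `LatticeWordStokes.small_of_plaqSmall`) the guard is inactive at EVERY coarse bond.
   With g0's `step04_liftCfgOfRecord₁₁` this is the per-step, per-block quantitative form of the (42) ↔ (0.4) pin for `step04 F N` itself: what separates the two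
   schemes on `SU(N)`-valued small fields is an exact coarse gradient (a gauge to first order, parts 11∕13) plus gauge-INVARIANT second order — numerically
   `≈ 0.1·ε³` on coarse plaquette traces (`W3-PIN-ANATOMY-v6` §2), never zero in general (part 23 + v6: no exact equivalence).
HONEST FRAMING.  [folklore] index∕word bookkeeping BY NAME over `BlockAveraging`, `B8Lemma1NonAbelian.tw`, `B12ContourAverage253.permWord`, n07-e's `Node00.AveragingSmooth`,
`ExpMeanLog`, `Node00.RateRecord11NE3Data`, part 22; 0 `def`, 0 `sorry`; the local exponential representation and the guard are DISPLAYED hypotheses; nothing about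
minimisers; nothing of [Balaban1985Averaging] ∕ [Balaban1987RG1] asserted beyond what the tree proves; K3⁸∕K3⁷ stubs NOT touched; N16 ∕ NE3 NOT discharged; count-neutral
(typed 28∕28 · discharged 5∕28 — unmoved).  One finite four-torus programme at fixed `ε` — the Yang–Mills mass gap (Clay) is NOT proved by any of this; R4 closes the
conditional finite-𝕋⁴ rung `BalabanLadder.UV` only; nothing continuum ∕ ℝ⁴ ∕ OS.
-/

set_option autoImplicit false

open scoped BigOperators Matrix Matrix.Norms.L2Operator
open NormedSpace

namespace Summit.QuantumFields.YangMills.BalabanUVNodes.N16Step04TorusBridge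

open Literature.MathematicalPhysics.QuantumFieldTheory.Balaban1983to89
open B7Prop1Explicit (Letter hol seg revWord disp e hol_nil hol_cons stepHol_true stepHol_false Letter.vec_true Letter.vec_false seg_natCast seg_negSucc asum treeWord l1 expRem)
open Summit.QuantumFields.YangMills.BalabanUVNodes.N16Eq04SameBlocksNonAbelian (norm_X04avg_sub_Xavg_sub_coarseGrad_le)
open B8Lemma1NonAbelian (tw tw_nil tw_cons)
open B12ContourAverage253 (permWord)
open Literature.MathematicalPhysics.QuantumFieldTheory.Balaban1983to89.T4Continuum
  (T4Family walk axisRun stairRuns stairWord loopWord wordRev)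
open BlockAveraging (Idx off loopHol Small)
open ExpMeanLog (expMeanLogSU eml eml_eq_exp_sum)
open Node00 (MatA SU ιSU cfgOfRecord avOfRecord liftCfgOfRecord₁₁ toTorusSite₁₁ coeField holM stepM loopM axialM corrM avgM)

noncomputable section

/-! ## §1 The (0.4) loop words of `BlockAveraging` ARE the symmetrised words of part 22 -/

section Words

variable {d : ℕ}

/-- `axisRun μ k = seg μ k` (the run of `|k|` steps `sign(k)·e_μ`). [folklore] -/
theorem axisRun_eq_seg (μ : Fin d) (k : ℤ) : axisRun μ k = seg μ k := by
  cases k with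
  | ofNat n => simp [axisRun, seg_natCast]
  | negSucc n => rw [seg_negSucc]; simp [axisRun]

/-- `stairRuns n ks = tw ks n` (runs of the listed axes in order). [folklore] -/
theorem stairRuns_eq_tw (n : Fin d → ℤ) : ∀ ks : List (Fin d), stairRuns n ks = tw ks n
  | [] => by rw [tw_nil]; rfl
  | a :: as => by rw [tw_cons, ← stairRuns_eq_tw n as, ← axisRun_eq_seg]; rfl

/-- **THE STAIRCASE WORD IS A PERMUTED TREE WORD**: `stairWord σ n = permWord (Fin.revPerm.trans σ) n` (`stairWord` lists the axes as `σ 0, σ 1, …`; b12's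
`permWord π` as `π (d−1), …, π 0`). [cite: Balaban1987RG1, (0.3) p.252 (shape)] -/
theorem stairWord_eq_permWord (σ : Equiv.Perm (Fin d)) (n : Fin d → ℤ) : stairWord σ n = permWord (σ * Fin.revPerm) n := by
  rw [stairWord, stairRuns_eq_tw, permWord, List.finRange_reverse, List.map_map]
  congr 1
  refine List.map_congr_left fun x _ => ?_
  simp [Equiv.Perm.coe_mul, Fin.revPerm_apply, Fin.rev_rev]

/-- `wordRev = revWord` (letterwise `flip = rev`, then reverse). [folklore] -/
theorem wordRev_eq_revWord (w : List (Letter d)) : wordRev w = revWord w := rfl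

/-- **THE (0.4) LOOP WORD IN b07∕b12 LETTERS**: `loopWord L μ n σ σ′ = permWord π n ++ seg μ L ++ revWord (permWord π′ n) ++ seg μ (−L)`, `π = rev ∘ σ`-reordered. [cite: Balaban1987RG1, (0.4) p.253 (shape)] -/
theorem loopWord_eq (L : ℕ) (μ : Fin d) (n : Fin d → ℤ) (σ σ' : Equiv.Perm (Fin d)) :
    loopWord L μ n σ σ' =
      permWord (σ * Fin.revPerm) n ++ seg μ L ++ revWord (permWord (σ' * Fin.revPerm) n) ++ seg μ (-(L : ℤ)) := by
  rw [loopWord, stairWord_eq_permWord, stairWord_eq_permWord, wordRev_eq_revWord, seg_natCast, B7Prop1Explicit.seg_neg_natCast]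
  simp only [List.append_assoc]

end Words

/-! ## §2 Transports of the record's lift are the torus walk products -/

section Lift

variable (F : T4Family) (N : ℕ)

/-- `toTorusSite (x + e_μ) = (toTorusSite x).shift μ`. [folklore] -/
theorem toTorusSite₁₁_add_e (t k : ℕ) (x : Fin 4 → ℤ) (μ : Fin 4) :
    toTorusSite₁₁ (F.P t) k (x + e μ) = (toTorusSite₁₁ (F.P t) k x).shift μ := by
  funext ν
  rw [Node00.toTorusSite₁₁_apply, Site.shift_apply, Node00.toTorusSite₁₁_apply, Node00.toTorusSite₁₁_apply, Pi.add_apply, B7Prop1Explicit.e_apply]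
  split_ifs <;> simp_all

/-- `toTorusSite (x − e_μ) = (toTorusSite x).unshift μ`. [folklore] -/
theorem toTorusSite₁₁_sub_e (t k : ℕ) (x : Fin 4 → ℤ) (μ : Fin 4) :
    toTorusSite₁₁ (F.P t) k (x - e μ) = (toTorusSite₁₁ (F.P t) k x).unshift μ := by
  funext ν
  rw [Node00.toTorusSite₁₁_apply, Site.unshift_apply, Node00.toTorusSite₁₁_apply, Node00.toTorusSite₁₁_apply, Pi.sub_apply, B7Prop1Explicit.e_apply]
  split_ifs <;> simp_all

/-- **★ TRANSPORTS OF THE RECORD's LIFT ARE THE TORUS WALK PRODUCTS**: for a torus field `V` and a `ℤ⁴` base point `x`, the b07 transport of the lift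
`liftCfgOfRecord₁₁ F N t k V` along any word `w` from `x` has the matrix of the walk product of `V` along `walk (toTorusSite x) w` (n07-e's `Node00.holM`). [folklore] -/
theorem coe_hol_lift (t k : ℕ) (V : cfgOfRecord F N t k) :
    ∀ (x : Fin 4 → ℤ) (w : List (Letter 4)),
      ((hol (liftCfgOfRecord₁₁ F N t k V) x w : (MatA N)ˣ) : MatA N) = holM (coeField V) (walk (toTorusSite₁₁ (F.P t) k x) w)
  | x, [] => by rw [hol_nil, Units.val_one]; rfl
  | x, (μ, true) :: w => by
      rw [hol_cons, Units.val_mul, stepHol_true, Letter.vec_true, coe_hol_lift t k V (x + e μ) w, toTorusSite₁₁_add_e]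
      show _ = holM (coeField V) (⟨⟨toTorusSite₁₁ (F.P t) k x, μ⟩, true⟩ :: walk ((toTorusSite₁₁ (F.P t) k x).shift μ) w)
      rw [Node00.holM_cons]
      rfl
  | x, (μ, false) :: w => by
      rw [hol_cons, Units.val_mul, stepHol_false, Letter.vec_false, ← sub_eq_add_neg, coe_hol_lift t k V (x - e μ) w, toTorusSite₁₁_sub_e]
      show _ = holM (coeField V) (⟨⟨(toTorusSite₁₁ (F.P t) k x).unshift μ, μ⟩, false⟩ :: walk ((toTorusSite₁₁ (F.P t) k x).unshift μ) w)
      rw [Node00.holM_cons, Node00.liftCfgOfRecord₁₁_apply, ← map_inv, Node00.coe_ιSU, toTorusSite₁₁_sub_e]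
      rfl

end Lift

/-! ## §3 On the guard, the (0.4) average OF RECORD is `exp` of a b07-word exponent of the lift times the lift's straight transporter -/

section Exponent

variable (F : T4Family) (N : ℕ) [NeZero N]

omit [NeZero N] in
/-- The (0.4) loop matrices of a torus field are the transports of its lift along the loop words, read from the `ℤ⁴` section of the block centre. [cite: Balaban1987RG1, (0.4) p.253 (bookkeeping)] -/
theorem coe_hol_lift_loopWord (t k : ℕ) (V : cfgOfRecord F N t k) (c : PBond (F.P t) (k + 1)) (i : Idx (F.P t)) :
    ((hol (liftCfgOfRecord₁₁ F N t k V) (fun μ : Fin 4 => ((emb c.src μ).val : ℤ)) (loopWord (F.P t).L c.dir (off i.1) i.2.1 i.2.2) : (MatA N)ˣ) :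
        MatA N) = loopM (coeField V) c i := by
  have hsec : toTorusSite₁₁ (F.P t) k (fun μ : Fin 4 => ((emb c.src μ).val : ℤ)) = emb c.src := Node00.toTorusSite₁₁_natCast_val _
  rw [coe_hol_lift, hsec]
  rfl

omit [NeZero N] in
/-- The straight transporter of (0.4) is the lift's transport along `seg c.dir L` from the centre section. [cite: Balaban1987RG1, (0.4) p.253 (bookkeeping)] -/
theorem coe_hol_lift_seg (t k : ℕ) (V : cfgOfRecord F N t k) (c : PBond (F.P t) (k + 1)) :
    ((hol (liftCfgOfRecord₁₁ F N t k V) (fun μ : Fin 4 => ((emb c.src μ).val : ℤ)) (seg c.dir ((F.P t).L : ℤ)) : (MatA N)ˣ) : MatA N) =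
      axialM (coeField V) c := by
  have hsec : toTorusSite₁₁ (F.P t) k (fun μ : Fin 4 => ((emb c.src μ).val : ℤ)) = emb c.src := Node00.toTorusSite₁₁_natCast_val _
  rw [coe_hol_lift, hsec, seg_natCast]
  rfl

/-- **★ THE (0.4) AVERAGE OF RECORD, ON ITS GUARD, IN b07 LETTERS**: for a torus field `V` with `Small expMeanLogSU V c` at the coarse bond `c`, the matrix of
`(avOfRecord F N t k).avg V c` is `exp(Σ_i |Idx|⁻¹ log V̂(loop_i)) · V̂(seg c.dir L)`, `V̂ = liftCfgOfRecord₁₁ F N t k V` read from the `ℤ⁴` section of `emb c₋`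
(n07-e's `Node00.coe_avgFun_of_small`, `eml_eq_exp_sum`, §2). [cite: Balaban1987RG1, (0.4) p.253] -/
theorem coe_avOfRecord_avg_of_small (t k : ℕ) (V : cfgOfRecord F N t k) (c : PBond (F.P t) (k + 1)) (h : Small expMeanLogSU V c) :
    (((avOfRecord F N t k).avg V c : SU N) : MatA N) =
      exp (∑ i : Idx (F.P t), ((Fintype.card (Idx (F.P t)) : ℝ))⁻¹ •
          MatrixLog.mlog ((hol (liftCfgOfRecord₁₁ F N t k V) (fun μ : Fin 4 => ((emb c.src μ).val : ℤ))
            (loopWord (F.P t).L c.dir (off i.1) i.2.1 i.2.2) : (MatA N)ˣ) : MatA N))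
        * ((hol (liftCfgOfRecord₁₁ F N t k V) (fun μ : Fin 4 => ((emb c.src μ).val : ℤ)) (seg c.dir ((F.P t).L : ℤ)) : (MatA N)ˣ) : MatA N) := by
  rw [Node00.avOfRecord_avg, Node00.coe_avgFun_of_small V c h]
  show corrM (coeField V) c * axialM (coeField V) c = _
  rw [corrM, eml_eq_exp_sum, coe_hol_lift_seg]
  congr 2
  exact Finset.sum_congr rfl fun i _ => by rw [coe_hol_lift_loopWord]

end Exponent

/-! ## §4 The exponent of record IS part 22's displayed (0.4)-shaped exponent at the base point `q + s = section of emb c₋`, `s = h·𝟙` -/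

section Identification

variable (F : T4Family) (N : ℕ) [NeZero N]

/-- `boxVec L r − h·𝟙 = off r` (`h = (L−1)∕2`): part 22's block offsets are `BlockAveraging`'s. [folklore] -/
theorem boxVec_sub_half_eq_off (t : ℕ) (r : Fin 4 → Fin F.L) :
    B7Prop1Explicit.boxVec F.L r - (fun _ : Fin 4 => (((F.L - 1) / 2 : ℕ) : ℤ)) = off (P := F.P t) r := by
  funext ν
  rfl

omit [NeZero N] in
/-- **★★ THE EXPONENT OF RECORD IS PART 22's (0.4)-SHAPED EXPONENT**: for ANY `ℤ⁴` configuration `W`, corner `q` and direction `κ`, the `Idx`-mean of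
`log W(loop_i)` over `BlockAveraging`'s loop words read from the centre `q + s`, `s = h·𝟙`, `h = (L−1)∕2`, equals part 22's displayed double mean at `(q, s)`
(`Idx = [0,L)⁴ × S₄ × S₄`, uniform weights `|Idx|⁻¹ = L^{−4}·(4!)^{−2}`; the staircase words are b12's `permWord` after `σ ↦ σ ∘ rev`, a bijection of `S₄`). [folklore] -/
theorem sum_idx_eq_symSum (t : ℕ) (W : (Fin 4 → ℤ) → Fin 4 → (MatA N)ˣ) (q : Fin 4 → ℤ) (κ : Fin 4) :
    (∑ i : Idx (F.P t), ((Fintype.card (Idx (F.P t)) : ℝ))⁻¹ •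
        MatrixLog.mlog ((hol W (q + fun _ : Fin 4 => (((F.L - 1) / 2 : ℕ) : ℤ)) (loopWord (F.P t).L κ (off i.1) i.2.1 i.2.2) : (MatA N)ˣ) : MatA N)) =
      ∑ r : Fin 4 → Fin F.L, (((F.L : ℝ) ^ 4)⁻¹) • ((((Fintype.card (Equiv.Perm (Fin 4)) : ℝ) ^ 2)⁻¹) •
        ∑ σ : Equiv.Perm (Fin 4), ∑ σ' : Equiv.Perm (Fin 4),
          MatrixLog.mlog ((hol W (q + fun _ : Fin 4 => (((F.L - 1) / 2 : ℕ) : ℤ))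
            (permWord σ (B7Prop1Explicit.boxVec F.L r - fun _ : Fin 4 => (((F.L - 1) / 2 : ℕ) : ℤ)) ++ seg κ F.L
              ++ revWord (permWord σ' (B7Prop1Explicit.boxVec F.L r - fun _ : Fin 4 => (((F.L - 1) / 2 : ℕ) : ℤ))) ++ seg κ (-(F.L : ℤ))) : (MatA N)ˣ) : MatA N)) := by
  -- the uniform weight `|Idx|⁻¹ = L^{-4}·(4!)^{-2}`
  have hcard : ((Fintype.card (Idx (F.P t)) : ℝ))⁻¹ = ((F.L : ℝ) ^ 4)⁻¹ * ((Fintype.card (Equiv.Perm (Fin 4)) : ℝ) ^ 2)⁻¹ := by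
    have h : Fintype.card (Idx (F.P t)) = F.L ^ 4 * (Fintype.card (Equiv.Perm (Fin 4)) * Fintype.card (Equiv.Perm (Fin 4))) := by
      show Fintype.card ((Fin (F.P t).d → Fin (F.P t).L) × Equiv.Perm (Fin (F.P t).d) × Equiv.Perm (Fin (F.P t).d)) = _
      rw [Fintype.card_prod, Fintype.card_prod, Fintype.card_fun, Fintype.card_fin, Fintype.card_fin]
      rfl
    rw [h]; push_cast; rw [mul_inv, sq]
  rw [Fintype.sum_prod_type]
  refine Finset.sum_congr rfl fun r _ => ?_
  rw [Fintype.sum_prod_type, smul_smul]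
  refine (Fintype.sum_equiv (Equiv.mulRight (Fin.revPerm : Equiv.Perm (Fin 4))) _ _ fun σ => ?_).trans (Finset.smul_sum ..).symm
  refine (Fintype.sum_equiv (Equiv.mulRight (Fin.revPerm : Equiv.Perm (Fin 4))) _ _ fun σ' => ?_).trans (Finset.smul_sum ..).symm
  rw [hcard]
  simp only [Equiv.coe_mulRight]
  rw [boxVec_sub_half_eq_off F t r, ← loopWord_eq]
  rfl

end Identification

/-! ## §5 THE PAYOFF: part 22's second-order bound holds VERBATIM for the exponent of the scheme OF RECORD -/

section Payoff

variable (F : T4Family) (N : ℕ) [NeZero N]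

omit [NeZero N] in
/-- **★★★ THE (0.4) OF RECORD AGAINST (42), QUANTITATIVELY** (part 22 for the ACTUAL scheme of record, not a fold-side model): for a `ℤ⁴` configuration `W` (e.g. the
record's lift `liftCfgOfRecord₁₁ F N t k V`) written near the block with corner `q` and centre `q + s`, `s = h·𝟙`, as `W_b = e^{A_b}`, `‖A_b‖ ≤ a` (within `ℓ_s` of the centre
and `ℓ` of the corner; `e^{ℓ_s a} − 1 ≤ ½`, `e^{ℓa} − 1 ≤ ½`), THE EXPONENT OF RECORD — the `Idx`-mean of `log W(loop_i)` over `BlockAveraging`'s (0.4) loop words from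
the centre (= the logarithm of the record's correction factor by `coe_avOfRecord_avg_of_small`) — MINUS (42)'s exponent `Xavg L W q κ` at the corner MINUS part 13's EXACT
coarse gradient has norm `≤ ρ₂(ℓ_s, a) + ρ₂(ℓ, a)`: second order only, no `O(L³δ)`. [folklore] -/
theorem norm_Xrecord_sub_Xavg_sub_coarseGrad_le (t : ℕ) (hL : 1 ≤ F.L) (W : (Fin 4 → ℤ) → Fin 4 → (MatA N)ˣ) (A : (Fin 4 → ℤ) → Fin 4 → MatA N)
    (q : Fin 4 → ℤ) (κ : Fin 4) {a : ℝ} (ha : 0 ≤ a)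
    (hVAs : ∀ (x : Fin 4 → ℤ) (μ : Fin 4), l1 (x - (q + fun _ : Fin 4 => (((F.L - 1) / 2 : ℕ) : ℤ))) ≤
        2 * (4 * F.L + l1 (fun _ : Fin 4 => (((F.L - 1) / 2 : ℕ) : ℤ))) + F.L + F.L → ((W x μ : (MatA N)ˣ) : MatA N) = exp (A x μ) ∧ ‖A x μ‖ ≤ a)
    (hVA : ∀ (x : Fin 4 → ℤ) (μ : Fin 4), l1 (x - q) ≤ 2 * (4 * F.L) + F.L + F.L → ((W x μ : (MatA N)ˣ) : MatA N) = exp (A x μ) ∧ ‖A x μ‖ ≤ a)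
    (hsmalls : Real.exp (((2 * (4 * F.L + l1 (fun _ : Fin 4 => (((F.L - 1) / 2 : ℕ) : ℤ))) + F.L + F.L : ℕ) : ℝ) * a) - 1 ≤ 1 / 2)
    (hsmall : Real.exp (((2 * (4 * F.L) + F.L + F.L : ℕ) : ℝ) * a) - 1 ≤ 1 / 2) :
    ‖(∑ i : Idx (F.P t), ((Fintype.card (Idx (F.P t)) : ℝ))⁻¹ •
        MatrixLog.mlog ((hol W (q + fun _ : Fin 4 => (((F.L - 1) / 2 : ℕ) : ℤ)) (loopWord (F.P t).L κ (off i.1) i.2.1 i.2.2) : (MatA N)ˣ) : MatA N))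
      - B7Prop1Explicit.Xavg F.L W q κ
      - (((∑ r : Fin 4 → Fin F.L, (((F.L : ℝ) ^ 4)⁻¹) • ((((Fintype.card (Equiv.Perm (Fin 4)) : ℝ))⁻¹) •
            ∑ σ : Equiv.Perm (Fin 4), (asum A (q + fun _ : Fin 4 => (((F.L - 1) / 2 : ℕ) : ℤ))
                (permWord σ (B7Prop1Explicit.boxVec F.L r - fun _ : Fin 4 => (((F.L - 1) / 2 : ℕ) : ℤ)))
              - asum A q (treeWord (B7Prop1Explicit.boxVec F.L r)))))
          - ∑ r : Fin 4 → Fin F.L, (((F.L : ℝ) ^ 4)⁻¹) • ((((Fintype.card (Equiv.Perm (Fin 4)) : ℝ))⁻¹) •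
            ∑ σ : Equiv.Perm (Fin 4), (asum A (q + (F.L : ℤ) • e κ + fun _ : Fin 4 => (((F.L - 1) / 2 : ℕ) : ℤ))
                (permWord σ (B7Prop1Explicit.boxVec F.L r - fun _ : Fin 4 => (((F.L - 1) / 2 : ℕ) : ℤ)))
              - asum A (q + (F.L : ℤ) • e κ) (treeWord (B7Prop1Explicit.boxVec F.L r)))))
        - (asum A (q + fun _ : Fin 4 => (((F.L - 1) / 2 : ℕ) : ℤ)) (seg κ F.L) - asum A q (seg κ F.L)))‖
      ≤ (expRem (2 * (Real.exp (((2 * (4 * F.L + l1 (fun _ : Fin 4 => (((F.L - 1) / 2 : ℕ) : ℤ))) + F.L + F.L : ℕ) : ℝ) * a) - 1))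
          + expRem (((2 * (4 * F.L + l1 (fun _ : Fin 4 => (((F.L - 1) / 2 : ℕ) : ℤ))) + F.L + F.L : ℕ) : ℝ) * a))
        + (expRem (2 * (Real.exp (((2 * (4 * F.L) + F.L + F.L : ℕ) : ℝ) * a) - 1)) + expRem (((2 * (4 * F.L) + F.L + F.L : ℕ) : ℝ) * a)) := by
  rw [sum_idx_eq_symSum]
  exact norm_X04avg_sub_Xavg_sub_coarseGrad_le F.L hL W A q _ κ ha hVAs hVA hsmalls hsmall

/-- **★★ THE RECORD's (0.4) AVERAGE AT A COARSE BOND, FROM THE CORNER**: on the guard, `avg V c = exp(X_rec) · V̂((q_c + s); seg c.dir L)` where `X_rec` is the `Idx`-mean of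
`§5`'s theorem at `W = V̂ = liftCfgOfRecord₁₁ F N t k V`, `q_c = (section of emb c₋) − s` (the CORNER of the record's block in `ℤ⁴` coordinates). [folklore] -/
theorem coe_avOfRecord_avg_eq_exp_corner (t k : ℕ) (V : cfgOfRecord F N t k) (c : PBond (F.P t) (k + 1)) (h : Small expMeanLogSU V c) :
    (((avOfRecord F N t k).avg V c : SU N) : MatA N) =
      exp (∑ i : Idx (F.P t), ((Fintype.card (Idx (F.P t)) : ℝ))⁻¹ •
          MatrixLog.mlog ((hol (liftCfgOfRecord₁₁ F N t k V)
            (((fun μ : Fin 4 => ((emb c.src μ).val : ℤ)) - fun _ : Fin 4 => (((F.L - 1) / 2 : ℕ) : ℤ)) + fun _ : Fin 4 => (((F.L - 1) / 2 : ℕ) : ℤ))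
            (loopWord (F.P t).L c.dir (off i.1) i.2.1 i.2.2) : (MatA N)ˣ) : MatA N))
        * ((hol (liftCfgOfRecord₁₁ F N t k V)
            (((fun μ : Fin 4 => ((emb c.src μ).val : ℤ)) - fun _ : Fin 4 => (((F.L - 1) / 2 : ℕ) : ℤ)) + fun _ : Fin 4 => (((F.L - 1) / 2 : ℕ) : ℤ))
            (seg c.dir ((F.P t).L : ℤ)) : (MatA N)ˣ) : MatA N) := by
  rw [sub_add_cancel]
  exact coe_avOfRecord_avg_of_small F N t k V c h

/-- **★★ ON SMALL FIELDS THE GUARD IS INACTIVE** (ym3-torus' `LatticeWordStokes.small_of_plaqSmall`): if every plaquette variable of `V` is within `δ` of `1` and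
`((6L)²∕4)·δ < δ_N = min(1∕3, π∕N)`, the formula of `coe_avOfRecord_avg_eq_exp_corner` holds at EVERY coarse bond — the record's average IS the printed (0.4) there, in b07
letters over the lift. [cite: Balaban1987RG1, (0.4) p.253] -/
theorem coe_avOfRecord_avg_eq_exp_corner_of_plaqSmall (t k : ℕ) (V : cfgOfRecord F N t k) {δ : ℝ} (hδ : 0 ≤ δ) (hV : PlaqSmall δ V)
    (hδN : ((((F.P t).d + 2) * (F.P t).L : ℕ) : ℝ) ^ 2 / 4 * δ < (expMeanLogSU (n := Fin N)).δ) (c : PBond (F.P t) (k + 1)) :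
    (((avOfRecord F N t k).avg V c : SU N) : MatA N) =
      exp (∑ i : Idx (F.P t), ((Fintype.card (Idx (F.P t)) : ℝ))⁻¹ •
          MatrixLog.mlog ((hol (liftCfgOfRecord₁₁ F N t k V)
            (((fun μ : Fin 4 => ((emb c.src μ).val : ℤ)) - fun _ : Fin 4 => (((F.L - 1) / 2 : ℕ) : ℤ)) + fun _ : Fin 4 => (((F.L - 1) / 2 : ℕ) : ℤ))
            (loopWord (F.P t).L c.dir (off i.1) i.2.1 i.2.2) : (MatA N)ˣ) : MatA N))
        * ((hol (liftCfgOfRecord₁₁ F N t k V)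
            (((fun μ : Fin 4 => ((emb c.src μ).val : ℤ)) - fun _ : Fin 4 => (((F.L - 1) / 2 : ℕ) : ℤ)) + fun _ : Fin 4 => (((F.L - 1) / 2 : ℕ) : ℤ))
            (seg c.dir ((F.P t).L : ℤ)) : (MatA N)ˣ) : MatA N) :=
  coe_avOfRecord_avg_eq_exp_corner F N t k V c (LatticeWordStokes.small_of_plaqSmall expMeanLogSU hδ hV hδN c)

end Payoff


end

end Summit.QuantumFields.YangMills.BalabanUVNodes.N16Step04TorusBridge
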